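import Summits.Ventures.Crystal3D.Theorems.StickyWulffConstantGenericWallFloorSharedOrthogonal
import HarnessLib

/-!
# Non-co-axial grains share at most one slot axis (crux `GenericWallFloor`, line `WallLedgerG`)

HONEST FRAMING. Part of the venture `Summits/Ventures/Crystal3D` (cell `crystal3d-full`), helper
`--supports` the crux `GenericWallFloor` (stmt-Ventures-19480) of `route-Ventures-StickyWulffConstant`,
registered line `WallLedgerG` (planner cf-p1 gen 16).  Consolidates `…SharedTriangle` (shared `60°`
pair ⇒ co-axial) and `…SharedOrthogonal` (shared `90°` pair ⇒ equal lattices): two unit vectors of one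
fcc lattice meet at `0°, 60°, 90°, 120°` or `180°` (`inner_mem_of_unit_slots`, from integrality of the
squared norms of lattice vectors, `exists_int_norm_sq_of_mem_fcc`), so for a NON-co-axial pair the common
unit vectors («slots») of the two linear lattices lie on ONE axis:
**`common_slots_antipodal_of_not_coaxial`** — `b = a` or `b = −a` for any two common slots `a, b`.
Reading for the slot ledger (seat 19480-p1's rigid rung, coincidence top sites): at a coincidence ball of
two non-co-axial grains at most two of its twelve slot directions are slots of both grains, and they are
antipodal.

WHAT THIS IS NOT: nothing about packings or walls; rung F-C1 not moved.
-/

noncomputable section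

namespace Summit.Ventures.Crystal3D.Theorems

open Literature.MathematicalPhysics.StatisticalMechanics
open Literature.Barriers.AtomisticToContinuum (barlowAddSubgroupOfConst)
open scoped InnerProductSpace

/-- **Squared norms of fcc lattice vectors are integers** (`Λ₀ ≅ D₃/√2`). -/
theorem exists_int_norm_sq_of_mem_fcc {p : EuclideanSpace ℝ (Fin 3)}
    (hp : p ∈ fccStacking 1 (Real.sqrt (2 / 3))) : ∃ m : ℤ, ‖p‖ ^ 2 = m := by
  obtain ⟨k, i, j, rfl⟩ := hp
  obtain ⟨hA, hB, hC⟩ := cubic_barlowPos k i j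
  have h := two_mul_norm_sq_eq_cubic (barlowPos 1 (Real.sqrt (2 / 3)) constHagg k i j)
  rw [hA, hB, hC] at h
  refine ⟨i ^ 2 + j ^ 2 + k ^ 2 + i * j + i * k + j * k, ?_⟩
  push_cast
  linear_combination (1 / 2 : ℝ) * h

/-- **Angles between slots of one rigid fcc lattice**: two unit vectors of `A·Λ₀` have inner product
`1, ½, 0, −½` or `−1`. -/
theorem inner_mem_of_unit_slots (A : EuclideanSpace ℝ (Fin 3) ≃ₗᵢ[ℝ] EuclideanSpace ℝ (Fin 3))
    {a b : EuclideanSpace ℝ (Fin 3)} (ha : a ∈ A '' fccStacking 1 (Real.sqrt (2 / 3)))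
    (hb : b ∈ A '' fccStacking 1 (Real.sqrt (2 / 3))) (ha1 : ‖a‖ = 1) (hb1 : ‖b‖ = 1) :
    ⟪a, b⟫_ℝ = 1 ∨ ⟪a, b⟫_ℝ = 1 / 2 ∨ ⟪a, b⟫_ℝ = 0 ∨ ⟪a, b⟫_ℝ = -(1 / 2) ∨ ⟪a, b⟫_ℝ = -1 := by
  obtain ⟨x, hx, rfl⟩ := ha
  obtain ⟨y, hy, rfl⟩ := hb
  set G₁ : AddSubgroup (EuclideanSpace ℝ (Fin 3)) :=
    barlowAddSubgroupOfConst 1 (Real.sqrt (2 / 3)) constHagg (fun _ => rfl) with hG₁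
  have hG₁mem : ∀ w, w ∈ G₁ ↔ w ∈ fccStacking 1 (Real.sqrt (2 / 3)) := fun w => Iff.rfl
  obtain ⟨m, hm⟩ := exists_int_norm_sq_of_mem_fcc ((hG₁mem _).1 (G₁.sub_mem ((hG₁mem _).2 hx) ((hG₁mem _).2 hy)))
  obtain ⟨n, hn⟩ := exists_int_norm_sq_of_mem_fcc ((hG₁mem _).1 (G₁.add_mem ((hG₁mem _).2 hx) ((hG₁mem _).2 hy)))
  rw [LinearIsometryEquiv.norm_map] at ha1 hb1
  rw [LinearIsometryEquiv.inner_map_map]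
  have hsub := norm_sub_sq_real x y
  have hadd := norm_add_sq_real x y
  rw [hm, ha1, hb1] at hsub
  rw [hn, ha1, hb1] at hadd
  -- `2⟪x,y⟫ = 2 − m = n − 2` is an integer between `−2` and `2`
  have h2 : 2 * ⟪x, y⟫_ℝ = 2 - m := by linarith
  have hle : |⟪x, y⟫_ℝ| ≤ 1 := by
    have := abs_real_inner_le_norm x y; rw [ha1, hb1, mul_one] at this; exact this
  obtain ⟨hlo, hhi⟩ := abs_le.1 hle
  have hm0 : 0 ≤ m := by
    have : (0 : ℝ) ≤ m := by rw [← hm]; positivity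
    exact_mod_cast this
  have hm4 : m ≤ 4 := by
    have : (m : ℝ) ≤ 4 := by linarith
    exact_mod_cast this
  have hcases : m = 0 ∨ m = 1 ∨ m = 2 ∨ m = 3 ∨ m = 4 := by omega
  rcases hcases with rfl | rfl | rfl | rfl | rfl
  · left; push_cast at h2; linarith
  · right; left; push_cast at h2; linarith
  · right; right; left; push_cast at h2; linarith
  · right; right; right; left; push_cast at h2; linarith
  · right; right; right; right; push_cast at h2; linarith

/-- **Non-co-axial grains share at most one slot axis.**  If the pair `(A₁·Λ₀ + t₁, A₂·Λ₀ + t₂)` is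
NOT co-axial (the `CoAx` clause of the wall cruxes fails), then any two unit vectors common to the linear
lattices `A₁·Λ₀`, `A₂·Λ₀` are equal or antipodal. -/
theorem common_slots_antipodal_of_not_coaxial
    (A₁ A₂ : EuclideanSpace ℝ (Fin 3) ≃ₗᵢ[ℝ] EuclideanSpace ℝ (Fin 3)) (t₁ t₂ : EuclideanSpace ℝ (Fin 3))
    (hnc : ¬ ∃ (L' : EuclideanSpace ℝ (Fin 3) ≃ₗᵢ[ℝ] EuclideanSpace ℝ (Fin 3))
      (s₁ s₂ : EuclideanSpace ℝ (Fin 3)) (σ σ' : ℤ → ℤ), IsHaggSeq σ ∧ IsHaggSeq σ' ∧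
      (fun p => A₁ p + t₁) '' fccStacking 1 (Real.sqrt (2 / 3)) ⊆
        (fun p => L' p + s₁) '' barlowStacking 1 (Real.sqrt (2 / 3)) σ ∧
      (fun p => A₂ p + t₂) '' fccStacking 1 (Real.sqrt (2 / 3)) ⊆
        (fun p => L' p + s₂) '' barlowStacking 1 (Real.sqrt (2 / 3)) σ')
    {a b : EuclideanSpace ℝ (Fin 3)}
    (ha₁ : a ∈ A₁ '' fccStacking 1 (Real.sqrt (2 / 3))) (hb₁ : b ∈ A₁ '' fccStacking 1 (Real.sqrt (2 / 3)))
    (ha₂ : a ∈ A₂ '' fccStacking 1 (Real.sqrt (2 / 3))) (hb₂ : b ∈ A₂ '' fccStacking 1 (Real.sqrt (2 / 3)))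
    (ha : ‖a‖ = 1) (hb : ‖b‖ = 1) : b = a ∨ b = -a := by
  have negmem : ∀ (A : EuclideanSpace ℝ (Fin 3) ≃ₗᵢ[ℝ] EuclideanSpace ℝ (Fin 3)) (v : EuclideanSpace ℝ (Fin 3)),
      v ∈ A '' fccStacking 1 (Real.sqrt (2 / 3)) → -v ∈ A '' fccStacking 1 (Real.sqrt (2 / 3)) := by
    rintro A _ ⟨p, hp, rfl⟩
    set G₁ : AddSubgroup (EuclideanSpace ℝ (Fin 3)) :=
      barlowAddSubgroupOfConst 1 (Real.sqrt (2 / 3)) constHagg (fun _ => rfl) with hG₁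
    have hG₁mem : ∀ w, w ∈ G₁ ↔ w ∈ fccStacking 1 (Real.sqrt (2 / 3)) := fun w => Iff.rfl
    exact ⟨-p, (hG₁mem _).1 (G₁.neg_mem ((hG₁mem _).2 hp)), by simp⟩
  have haa : ⟪a, a⟫_ℝ = 1 := by rw [real_inner_self_eq_norm_sq, ha, one_pow]
  have hbb : ⟪b, b⟫_ℝ = 1 := by rw [real_inner_self_eq_norm_sq, hb, one_pow]
  rcases inner_mem_of_unit_slots A₁ ha₁ hb₁ ha hb with h | h | h | h | h
  · -- `⟪a,b⟫ = 1`: equal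
    left
    have : ‖b - a‖ ^ 2 = 0 := by
      rw [norm_sub_sq_real, real_inner_comm, h, ha, hb]; norm_num
    exact sub_eq_zero.1 (norm_eq_zero.1 (pow_eq_zero_iff two_ne_zero |>.1 this))
  · exact absurd (coaxial_of_shared_adjacent_slots A₁ A₂ t₁ t₂ a b ha₁ hb₁ ha₂ hb₂ ha hb h) hnc
  · exact absurd (coaxial_of_image_eq A₁ A₂ t₁ t₂
      (eq_of_shared_orthogonal_slots A₁ A₂ a b ha₁ hb₁ ha₂ hb₂ ha hb h)) hnc
  · refine absurd (coaxial_of_shared_adjacent_slots A₁ A₂ t₁ t₂ a (-b) ha₁ (negmem A₁ b hb₁) ha₂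
      (negmem A₂ b hb₂) ha (by rw [norm_neg, hb]) ?_) hnc
    rw [inner_neg_right, h]; norm_num
  · -- `⟪a,b⟫ = −1`: antipodal
    right
    have : ‖b + a‖ ^ 2 = 0 := by
      rw [norm_add_sq_real, real_inner_comm, h, ha, hb]; norm_num
    exact eq_neg_of_add_eq_zero_left (norm_eq_zero.1 (pow_eq_zero_iff two_ne_zero |>.1 this))

end Summit.Ventures.Crystal3D.Theorems

end
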